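import Literature.AlgebraicGeometry.Resolution.BlowupRelativeDimension
import Mathlib.RingTheory.Ideal.KrullsHeightTheorem
import HarnessLib

/-!
# Matsumura's fibre inequality `dim B ≤ dim A + dim B/𝔪_A B` in codimension form:
# `codim_{cl ζ'}(x') ≤ codim_{cl π ζ'}(π x') + dim 𝒪_{X',x'}/𝔪_{π x'}𝒪_{X',x'}` for any morphism `π`

Topic: `Literature/AlgebraicGeometry/Resolution`. H. Matsumura, *Commutative Ring Theory*, Thm. 15.1 (i):
"Let `φ : A → B` be a homomorphism of Noetherian rings, `P` a prime of `B`, `𝔭 = P ∩ A`. Then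
`ht P ≤ ht 𝔭 + dim B_P/𝔭B_P`" (Mathlib `Ideal.height_le_height_add_of_liesOver`, Stacks 00OM). This file
PROVES its reading for a morphism of locally Noetherian schemes `π : X' → X`, a point `x'` and a
generisation `ζ' ⤳ x'`, applied to the local homomorphism of DOMAINS
`𝒪_{X,π x'}/𝔭_{π ζ'} → 𝒪_{X',x'}/𝔭_{ζ'}` (`𝔭_ζ` the prime of a generisation, `(π^♯)⁻¹𝔭_{ζ'} = 𝔭_{π ζ'}`):

* `coheight_closure_le_add_ringKrullDim_fibre` — **`codim_{cl ζ'}(x') ≤ codim_{cl π ζ'}(π x') + dim 𝒪_{X',x'}/𝔪_{π x'}𝒪_{X',x'}`**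
  (codimensions in the specialisation order of Mathlib, `a ≤ b ↔ b ⤳ a`; the last term is the dimension at
  `x'` of the whole fibre `π⁻¹(π x')`, which bounds the fibre term `dim (𝒪_{cl ζ',x'}/𝔪_{π x'})` of Thm. 15.1);
* `coheight_le_coheight_closure_image_add_ringKrullDim_fibre` — the same for an irreducible closed `Z' ∋ x'`
  and `B = cl π(Z')`.

With the tree's `IsBlowup.ringKrullDim_stalk_quotient_map_maximalIdeal_add_le` (the fibres of a permissible
blow-up, `PermissibleBlowupFibreDimension.lean`) this bounds the depth of the components of the exceptional
divisor through a point (the Hironaka campaign's W4.2 binder `StrataDepthDiscipline`, conjunct (a)).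
No definitions, no named facts; nothing specific to resolution of singularities.

## Sources

* H. Matsumura, *Commutative Ring Theory* (1986), Thm. 15.1 (i). [Matsumura1987]
* The Stacks Project, Tags 00OM, 01J7, 02IZ. [StacksProject]
-/

noncomputable section

open CategoryTheory AlgebraicGeometry TopologicalSpace Topology IsLocalRing Order

namespace Literature.AlgebraicGeometry.Resolution

universe u

variable {X X' : Scheme.{u}}

/-- For a local ring `A` and an ideal `J ≠ ⊤`, the quotient map detects the maximal ideal:
`(𝔪_{A/J}).comap mk = 𝔪_A`. [folklore] -/
private theorem comap_mk_maximalIdeal {A : Type u} [CommRing A] [IsLocalRing A] (J : Ideal A) (hJ : J ≠ ⊤) :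
    haveI : Nontrivial (A ⧸ J) := Ideal.Quotient.nontrivial_iff.mpr hJ
    haveI : IsLocalRing (A ⧸ J) := IsLocalRing.of_surjective' (Ideal.Quotient.mk J) Ideal.Quotient.mk_surjective
    (maximalIdeal (A ⧸ J)).comap (Ideal.Quotient.mk J) = maximalIdeal A := by
  haveI : Nontrivial (A ⧸ J) := Ideal.Quotient.nontrivial_iff.mpr hJ
  haveI : IsLocalRing (A ⧸ J) := IsLocalRing.of_surjective' (Ideal.Quotient.mk J) Ideal.Quotient.mk_surjective
  haveI := IsLocalHom.of_surjective (Ideal.Quotient.mk J) Ideal.Quotient.mk_surjective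
  exact maximalIdeal_comap _

/-- **MATSUMURA'S FIBRE INEQUALITY IN CODIMENSION FORM.** For a morphism `π : X' → X` of locally
Noetherian schemes and a generisation `ζ' ⤳ x'`:
`codim_{cl ζ'}(x') ≤ codim_{cl π ζ'}(π x') + dim 𝒪_{X',x'}/𝔪_{π x'}𝒪_{X',x'}` — Thm. 15.1 (i) for the local
homomorphism `𝒪_{X,π x'}/𝔭_{π ζ'} → 𝒪_{X',x'}/𝔭_{ζ'}`, whose fibre ring is a quotient of
`𝒪_{X',x'}/𝔪_{π x'}𝒪_{X',x'}`. [cite: Matsumura1987, Thm. 15.1] [cite: StacksProject, Tag 00OM] -/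
theorem coheight_closure_le_add_ringKrullDim_fibre [IsLocallyNoetherian X] [IsLocallyNoetherian X'] (π : X' ⟶ X) {ζ' x' : X'}
    (h : ζ' ⤳ x') :
    ((coheight (⟨x', specializes_iff_mem_closure.mp h⟩ : ↥(closure ({ζ'} : Set X'))) : ℕ∞) : WithBot ℕ∞) ≤
      ((coheight (⟨π.base x', specializes_iff_mem_closure.mp (h.map π.continuous)⟩ :
          ↥(closure ({π.base ζ'} : Set X))) : ℕ∞) : WithBot ℕ∞) +
        ringKrullDim (X'.presheaf.stalk x' ⧸ (maximalIdeal (X.presheaf.stalk (π.base x'))).map (π.stalkMap x').hom) := by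
  -- the rings
  set O := X.presheaf.stalk (π.base x') with hO
  set O' := X'.presheaf.stalk x' with hO'
  set f : O →+* O' := (π.stalkMap x').hom with hf
  set 𝔮' : Ideal O' := primeOfSpecializes h with h𝔮'
  set 𝔮 : Ideal O := primeOfSpecializes (h.map π.continuous : π.base ζ' ⤳ π.base x') with h𝔮def
  have h𝔮 : 𝔮'.comap f = 𝔮 := comap_stalkMap_primeOfSpecializes π h
  haveI : 𝔮'.IsPrime := by rw [h𝔮']; infer_instance
  haveI : 𝔮.IsPrime := by rw [h𝔮def]; infer_instance
  -- `R = 𝒪/𝔮 → S = 𝒪'/𝔮'`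
  set g : O ⧸ 𝔮 →+* O' ⧸ 𝔮' := Ideal.quotientMap 𝔮' f (by rw [h𝔮]) with hg
  letI : Algebra (O ⧸ 𝔮) (O' ⧸ 𝔮') := g.toAlgebra
  haveI : Nontrivial (O ⧸ 𝔮) := Ideal.Quotient.nontrivial_iff.mpr (Ideal.IsPrime.ne_top inferInstance)
  haveI : Nontrivial (O' ⧸ 𝔮') := Ideal.Quotient.nontrivial_iff.mpr (Ideal.IsPrime.ne_top inferInstance)
  haveI : IsLocalRing (O ⧸ 𝔮) := IsLocalRing.of_surjective' (Ideal.Quotient.mk 𝔮) Ideal.Quotient.mk_surjective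
  haveI : IsLocalRing (O' ⧸ 𝔮') := IsLocalRing.of_surjective' (Ideal.Quotient.mk 𝔮') Ideal.Quotient.mk_surjective
  -- `g` is local: `𝔪_S ∩ R = 𝔪_R`
  have hcomap : (maximalIdeal (O' ⧸ 𝔮')).comap g = maximalIdeal (O ⧸ 𝔮) := by
    apply Ideal.comap_injective_of_surjective (Ideal.Quotient.mk 𝔮) Ideal.Quotient.mk_surjective
    rw [Ideal.comap_comap, comap_mk_maximalIdeal 𝔮 (Ideal.IsPrime.ne_top inferInstance)]
    have hgc : g.comp (Ideal.Quotient.mk 𝔮) = (Ideal.Quotient.mk 𝔮').comp f := by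
      ext r; rfl
    rw [hgc, ← Ideal.comap_comap, comap_mk_maximalIdeal 𝔮' (Ideal.IsPrime.ne_top inferInstance), hf]
    exact maximalIdeal_comap _
  haveI : (maximalIdeal (O' ⧸ 𝔮')).LiesOver (maximalIdeal (O ⧸ 𝔮)) := ⟨by rw [Ideal.under_def]; exact hcomap.symm⟩
  -- Matsumura 15.1 (i)
  have key := Ideal.height_le_height_add_of_liesOver (maximalIdeal (O ⧸ 𝔮)) (maximalIdeal (O' ⧸ 𝔮'))
  -- the fibre ring `T = S/𝔪_R S` is a quotient of `F = 𝒪'/𝔪_𝒪 𝒪'`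
  set J : Ideal O' := (maximalIdeal O).map f with hJ
  set T := (O' ⧸ 𝔮') ⧸ (maximalIdeal (O ⧸ 𝔮)).map (algebraMap (O ⧸ 𝔮) (O' ⧸ 𝔮')) with hT
  haveI : IsLocalRing T := by
    haveI : Nontrivial T := Ideal.Quotient.nontrivial_iff.mpr (by
      refine ne_top_of_le_ne_top (Ideal.IsPrime.ne_top (inferInstance : (maximalIdeal (O' ⧸ 𝔮')).IsPrime)) ?_
      rw [Ideal.map_le_iff_le_comap]
      exact le_of_eq hcomap.symm)
    exact IsLocalRing.of_surjective' (Ideal.Quotient.mk _) Ideal.Quotient.mk_surjective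
  have hTF : ringKrullDim T ≤ ringKrullDim (O' ⧸ J) := by
    -- the surjection `𝒪'/J → T`
    have hJle : J ≤ RingHom.ker ((Ideal.Quotient.mk ((maximalIdeal (O ⧸ 𝔮)).map (algebraMap (O ⧸ 𝔮) (O' ⧸ 𝔮')))).comp
        (Ideal.Quotient.mk 𝔮')) := by
      rw [hJ, Ideal.map_le_iff_le_comap]
      intro r hr
      rw [Ideal.mem_comap, RingHom.mem_ker, RingHom.comp_apply, Ideal.Quotient.eq_zero_iff_mem]
      have h1 : Ideal.Quotient.mk 𝔮' (f r) = algebraMap (O ⧸ 𝔮) (O' ⧸ 𝔮') (Ideal.Quotient.mk 𝔮 r) := rfl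
      rw [h1]
      refine Ideal.mem_map_of_mem (algebraMap (O ⧸ 𝔮) (O' ⧸ 𝔮')) ?_
      have h2 : Ideal.Quotient.mk 𝔮 r ∈ (maximalIdeal O).map (Ideal.Quotient.mk 𝔮) := Ideal.mem_map_of_mem _ hr
      rwa [map_maximalIdeal_of_surjective (Ideal.Quotient.mk 𝔮) Ideal.Quotient.mk_surjective] at h2
    refine ringKrullDim_le_of_surjective (Ideal.Quotient.lift J _ fun a ha => hJle ha) ?_
    intro t
    obtain ⟨s, rfl⟩ := Ideal.Quotient.mk_surjective t
    obtain ⟨o, rfl⟩ := Ideal.Quotient.mk_surjective s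
    exact ⟨Ideal.Quotient.mk J o, rfl⟩
  -- heights ↔ codimensions
  have hS : ((coheight (⟨x', specializes_iff_mem_closure.mp h⟩ : ↥(closure ({ζ'} : Set X'))) : ℕ∞) : WithBot ℕ∞) =
      (maximalIdeal (O' ⧸ 𝔮')).height := by
    rw [coheight_closure_eq_ringKrullDim_quotient h, IsLocalRing.maximalIdeal_height_eq_ringKrullDim]
  have hR : ((coheight (⟨π.base x', specializes_iff_mem_closure.mp (h.map π.continuous)⟩ :
      ↥(closure ({π.base ζ'} : Set X))) : ℕ∞) : WithBot ℕ∞) = (maximalIdeal (O ⧸ 𝔮)).height := by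
    rw [coheight_closure_eq_ringKrullDim_quotient (h.map π.continuous), IsLocalRing.maximalIdeal_height_eq_ringKrullDim]
  have hTh : (((maximalIdeal (O' ⧸ 𝔮')).map (Ideal.Quotient.mk ((maximalIdeal (O ⧸ 𝔮)).map
      (algebraMap (O ⧸ 𝔮) (O' ⧸ 𝔮'))))).height : WithBot ℕ∞) = ringKrullDim T := by
    have hmax : (maximalIdeal (O' ⧸ 𝔮')).map (Ideal.Quotient.mk ((maximalIdeal (O ⧸ 𝔮)).map
        (algebraMap (O ⧸ 𝔮) (O' ⧸ 𝔮')))) = maximalIdeal T :=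
      map_maximalIdeal_of_surjective _ Ideal.Quotient.mk_surjective
    rw [hmax, IsLocalRing.maximalIdeal_height_eq_ringKrullDim]
  rw [hS, hR]
  calc ((maximalIdeal (O' ⧸ 𝔮')).height : WithBot ℕ∞)
      ≤ (((maximalIdeal (O ⧸ 𝔮)).height + ((maximalIdeal (O' ⧸ 𝔮')).map (Ideal.Quotient.mk
          ((maximalIdeal (O ⧸ 𝔮)).map (algebraMap (O ⧸ 𝔮) (O' ⧸ 𝔮'))))).height : ℕ∞) : WithBot ℕ∞) := by
        exact_mod_cast key
    _ = ((maximalIdeal (O ⧸ 𝔮)).height : WithBot ℕ∞) + ringKrullDim T := by rw [← hTh]; push_cast; rfl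
    _ ≤ ((maximalIdeal (O ⧸ 𝔮)).height : WithBot ℕ∞) + ringKrullDim (O' ⧸ J) := add_le_add le_rfl hTF

/-- **The same for an irreducible closed subset**: for `π : X' → X` of locally Noetherian schemes, an
irreducible closed `Z' ⊆ X'` through `x'` and `B = cl π(Z')`:
`codim_{Z'}(x') ≤ codim_B(π x') + dim 𝒪_{X',x'}/𝔪_{π x'}𝒪_{X',x'}`. [cite: Matsumura1987, Thm. 15.1] -/
theorem coheight_le_coheight_closure_image_add_ringKrullDim_fibre [IsLocallyNoetherian X] [IsLocallyNoetherian X']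
    (π : X' ⟶ X)
    {Z' : Set X'} (hirr : IsIrreducible Z') (hcl : IsClosed Z') {x' : X'} (hx' : x' ∈ Z') :
    ((coheight (⟨x', hx'⟩ : ↥Z') : ℕ∞) : WithBot ℕ∞) ≤
      ((coheight (⟨π.base x', subset_closure ⟨x', hx', rfl⟩⟩ : ↥(closure (π.base '' Z'))) : ℕ∞) : WithBot ℕ∞) +
        ringKrullDim (X'.presheaf.stalk x' ⧸ (maximalIdeal (X.presheaf.stalk (π.base x'))).map (π.stalkMap x').hom) := by
  have hgen : IsGenericPoint hirr.genericPoint Z' := hirr.isGenericPoint_genericPoint hcl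
  set ζ' := hirr.genericPoint with hζ'def
  have hsp : ζ' ⤳ x' := hgen.specializes hx'
  have hBeq : closure (π.base '' Z') = closure {π.base ζ'} := by
    apply le_antisymm
    · refine closure_minimal ?_ isClosed_closure
      rintro _ ⟨z, hz, rfl⟩
      exact specializes_iff_mem_closure.mp ((hgen.specializes hz).map π.continuous)
    · exact closure_minimal (Set.singleton_subset_iff.mpr (subset_closure ⟨ζ', hgen.mem, rfl⟩)) isClosed_closure
  have key := coheight_closure_le_add_ringKrullDim_fibre π hsp
  have e1 : coheight (⟨x', hx'⟩ : ↥Z') =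
      coheight (⟨x', specializes_iff_mem_closure.mp hsp⟩ : ↥(closure ({ζ'} : Set X'))) := by
    have hZ : closure ({ζ'} : Set X') = Z' := hgen.def
    exact (coheight_orderIso (OrderIso.setCongr _ _ hZ.symm) ⟨x', hx'⟩).symm
  have e2 : coheight (⟨π.base x', subset_closure ⟨x', hx', rfl⟩⟩ : ↥(closure (π.base '' Z'))) =
      coheight (⟨π.base x', specializes_iff_mem_closure.mp (hsp.map π.continuous)⟩ :
        ↥(closure ({π.base ζ'} : Set X))) :=
    (coheight_orderIso (OrderIso.setCongr (closure (π.base '' Z')) (closure ({π.base ζ'} : Set X)) hBeq)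
      ⟨π.base x', subset_closure ⟨x', hx', rfl⟩⟩).symm
  rw [e1, e2]
  exact key

end Literature.AlgebraicGeometry.Resolution

end
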